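import Summits.ResolutionOfSingularities.ResolutionOfSingularities.Theorems.WeightedInvariantIota3FlagBridge
import Summits.ResolutionOfSingularities.ResolutionOfSingularities.Theorems.WeightedInvariantIota3FlagTools
import HarnessLib

/-!
# RATIO-MAXIMALITY FORBIDS A SOLVABLE FIRST FACE: `f ∉ ((g₁ − t·g₂^ρ)^ν) + 𝔪·F(r₁ν − q) + F(r₁ν + 1)` at an exactly ratio-maximal
# `(q; r₁, r₂)` with `q < r₂` (door `HypersurfaceCentreConstruction`, stmt-ResolutionOfSingularities-19897; first brick of the residue hres₃
# of `keyRungGrHomLE_three_of_residue3`)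

Helper for `stub_keyRungGrHomLE_three` (def-free, `--supports 19897`).  In any local ring, for the two-flag filtration
`F = F_{(g₁,g₂; q,r₁,r₂)}` (`Iota3.flagContactFiltration`):

* `flagContactFiltration_le_of_weights` / `maximalIdeal_mul_flagContactFiltration_le_of_weights` — comparison of the filtrations of
  ONE flag at two weight triples, piece by piece, from an inequality between weights («every monomial `g₁^α g₂^β 𝔪^k` of
  `(q;r₁,r₂)`-weight `≥ n` has `(Q;R₁,R₂)`-weight `≥ N`»);
* `span_pow_sup_le_reach_succ` — THE PERTURBED TRIPLE: `(g₁^ν) + 𝔪·F(r₁ν − q) + F(r₁ν + 1) ≤ F_{(g₁,g₂; r₂ν, r₁ν+1, r₂ν)}((r₁ν+1)·ν)`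
  for `0 < q < r₂ ≤ r₁`: the triple `(r₂ν; r₁ν+1, r₂ν)` is admissible of ratio `(r₁ν+1)/(r₂ν) > r₁/r₂`;
* `not_mem_span_pow_sup_of_ratio_bound` / `not_mem_span_shift_pow_sup_of_ratio_bound` — **LEMMA B**: under the ratio bound `a/b` of the
  dominance word (`∀` admissible reached `(q';r₁',r₂')`, `r₁' b ≤ a r₂'`, `0 < b`) and `r₁ b = a r₂`, `q < r₂`, for a two-flag `(g₁, g₂)`:
  `f ∉ (g₁^ν) + 𝔪·F(r₁ν − q) + F(r₁ν+1)` and, when `r₁ = ρ r₂`, `f ∉ ((g₁ − t g₂^ρ)^ν) + 𝔪·F(r₁ν − q) + F(r₁ν+1)` for every `t`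
  (`ν = ord f`).  READING: in the graded ring `κ[X, V, Y]` of `F` (weights `q, r₂, r₁` on a completing `x`, `g₂`, `g₁`) the initial
  form of `f` does not lie in `((Y − t̄ V^ρ)^ν, X)` — the first face `in(f) mod X ∈ κ[V, Y]` is NOT `c·(Y − t̄ V^ρ)^ν`: exactly
  ratio-maximal weights are never solvable.  This is the use of maximality in the proof plan for the residue hres₃ (memo RESIDUE-PLAN.md).

[OURS · L1 W4.3 · (o70-b)/(Δ12); AI work, weaker than expert review; nothing here is a statement of the manuscript under review.]

## References
* V. Cossart, O. Piltant, J. Algebra 320 (2008), §4 p. 11 (solvable vertices). [CossartPiltant2008]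
* H. Hironaka, J. Math. Kyoto Univ. 7 (1967), §3. [Hironaka1967]
-/

noncomputable section

open IsLocalRing Literature.AlgebraicGeometry.Resolution
open Summit.ResolutionOfSingularities.ResolutionOfSingularities.Theorems

set_option linter.dupNamespace false -- mandated namespace of this single-conjunct summit

namespace Summit.ResolutionOfSingularities.ResolutionOfSingularities.Cruxes.HypersurfaceCentreConstruction.LocalEngine

namespace Iota3

universe u

variable {S : Type u} [CommRing S] [IsLocalRing S]

/-! ## §1 Comparing the filtrations of one flag at two weight triples -/

/-- The ceiling step: `n − r₁α − r₂β ≤ q · ⌈(n − r₁α − r₂β)/q⌉`. [folklore] -/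
theorem le_mul_pieceExponent {q : ℕ} (hq : 0 < q) (n r₁ r₂ α β : ℕ) :
    n ≤ r₁ * α + r₂ * β + q * ((n - r₁ * α - r₂ * β + q - 1) / q) := by
  set A := n - r₁ * α - r₂ * β with hA
  have h := Nat.lt_div_mul_add (a := A + q - 1) hq
  have h2 : (A + q - 1) / q * q = q * ((A + q - 1) / q) := mul_comm _ _
  omega

/-- **Comparison by weights**: if every `g₁^α g₂^β 𝔪^k` of `(q; r₁, r₂)`-weight `≥ n` has `(Q; R₁, R₂)`-weight `≥ N`, then
`F_{(q;r₁,r₂)}(n) ≤ F_{(Q;R₁,R₂)}(N)` for the same flag. [folklore] -/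
theorem flagContactFiltration_le_of_weights {g₁ g₂ : S} {q r₁ r₂ n Q R₁ R₂ N : ℕ} (hq : 0 < q) (hQ : 0 < Q)
    (h : ∀ α β k : ℕ, n ≤ r₁ * α + r₂ * β + q * k → N ≤ R₁ * α + R₂ * β + Q * k) :
    flagContactFiltration g₁ g₂ q r₁ r₂ n ≤ flagContactFiltration g₁ g₂ Q R₁ R₂ N := by
  rw [flagContactFiltration_def g₁ g₂ q]
  refine iSup_le fun α => iSup_le fun β => ?_
  rw [Ideal.mul_le]
  intro i hi j hj
  obtain ⟨d, rfl⟩ := Ideal.mem_span_singleton'.mp hi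
  have hN := h α β _ (le_mul_pieceExponent hq n r₁ r₂ α β)
  have hmem := mul_mem_flagContactFiltration_of_weight (g₁ := g₁) (g₂ := g₂) (r₁ := R₁) (r₂ := R₂) hQ
    (Ideal.mul_mem_left _ d hj) hN
  have heq : d * (g₁ ^ α * g₂ ^ β) * j = g₁ ^ α * g₂ ^ β * (d * j) := by ring
  rwa [heq]

/-- **Comparison by weights, with one extra factor of `𝔪`**: if every `g₁^α g₂^β 𝔪^{k+1}` with `(q;r₁,r₂)`-weight of
`g₁^α g₂^β 𝔪^k` at least `n` has `(Q;R₁,R₂)`-weight `≥ N`, then `𝔪 · F_{(q;r₁,r₂)}(n) ≤ F_{(Q;R₁,R₂)}(N)`. [folklore] -/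
theorem maximalIdeal_mul_flagContactFiltration_le_of_weights {g₁ g₂ : S} {q r₁ r₂ n Q R₁ R₂ N : ℕ} (hq : 0 < q) (hQ : 0 < Q)
    (h : ∀ α β k : ℕ, n ≤ r₁ * α + r₂ * β + q * k → N ≤ R₁ * α + R₂ * β + Q * (k + 1)) :
    maximalIdeal S * flagContactFiltration g₁ g₂ q r₁ r₂ n ≤ flagContactFiltration g₁ g₂ Q R₁ R₂ N := by
  rw [flagContactFiltration_def g₁ g₂ q, Ideal.mul_iSup]
  refine iSup_le fun α => ?_
  rw [Ideal.mul_iSup]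
  refine iSup_le fun β => ?_
  rw [Ideal.mul_le]
  intro m hm y hy
  -- `y` lies in the piece `(g₁^α g₂^β) · 𝔪^e`; decompose it through `Ideal.mul_le` once more
  refine Submodule.mul_induction_on hy (fun i hi j hj => ?_) (fun y₁ y₂ h₁ h₂ => by rw [mul_add]; exact Ideal.add_mem _ h₁ h₂)
  obtain ⟨d, rfl⟩ := Ideal.mem_span_singleton'.mp hi
  have hN := h α β _ (le_mul_pieceExponent hq n r₁ r₂ α β)
  have hmj : m * (d * j) ∈ maximalIdeal S ^ ((n - r₁ * α - r₂ * β + q - 1) / q + 1) := by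
    rw [pow_succ', show m * (d * j) = m * (d * j) from rfl]
    exact Ideal.mul_mem_mul hm (Ideal.mul_mem_left _ d hj)
  have hmem := mul_mem_flagContactFiltration_of_weight (g₁ := g₁) (g₂ := g₂) (r₁ := R₁) (r₂ := R₂) hQ hmj hN
  have heq : m * (d * (g₁ ^ α * g₂ ^ β) * j) = g₁ ^ α * g₂ ^ β * (m * (d * j)) := by ring
  rwa [heq]

/-! ## §2 The perturbed triple `(r₂ν; r₁ν+1, r₂ν)` -/

/-- Weight bookkeeping for `𝔪 · F(r₁ν − q)`: `q < r₂ ≤ r₁`, `1 ≤ ν`, `r₁ν − q ≤ r₁α + r₂β + qk` ⇒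
`(r₁ν+1)ν ≤ (r₁ν+1)α + r₂νβ + r₂ν(k+1)`. [folklore] -/
theorem perturb_weight_mul {q r₁ r₂ ν α β k : ℕ} (hq₂ : q < r₂) (hr : r₂ ≤ r₁) (hν : 1 ≤ ν)
    (h : r₁ * ν - q ≤ r₁ * α + r₂ * β + q * k) :
    (r₁ * ν + 1) * ν ≤ (r₁ * ν + 1) * α + r₂ * ν * β + r₂ * ν * (k + 1) := by
  have hr₁ν : q ≤ r₁ * ν := le_trans (le_trans hq₂.le hr) (Nat.le_mul_of_pos_right r₁ hν)
  have h' : r₁ * ν ≤ r₁ * α + r₂ * β + q * (k + 1) := by rw [Nat.mul_succ]; omega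
  rcases le_or_gt α ν with hαν | hνα
  · obtain ⟨d, rfl⟩ := Nat.exists_eq_add_of_le hαν
    obtain ⟨e, rfl⟩ := Nat.exists_eq_add_of_lt hq₂
    have h1 : r₁ * d ≤ (q + e + 1) * β + q * (k + 1) := by
      have : r₁ * (α + d) = r₁ * α + r₁ * d := by ring
      omega
    have P1 : (α + d) * (r₁ * d) ≤ (α + d) * ((q + e + 1) * β + q * (k + 1)) := Nat.mul_le_mul_left _ h1
    have P2 : d ≤ (α + d) * ((k + 1) * (1 + e)) := by
      have h4 : 1 ≤ (k + 1) * (1 + e) := Nat.one_le_iff_ne_zero.mpr (Nat.mul_ne_zero (by omega) (by omega))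
      calc d ≤ (α + d) * 1 := by omega
        _ ≤ (α + d) * ((k + 1) * (1 + e)) := Nat.mul_le_mul_left _ h4
    nlinarith [P1, P2]
  · have h1 : (r₁ * ν + 1) * ν ≤ (r₁ * ν + 1) * α := Nat.mul_le_mul_left _ hνα.le
    omega

/-- Weight bookkeeping for `F(r₁ν + 1)`: `0 < q ≤ r₂ ≤ r₁`, `r₁ν + 1 ≤ r₁α + r₂β + qk` ⇒
`(r₁ν+1)ν ≤ (r₁ν+1)α + r₂νβ + r₂νk`. [folklore] -/
theorem perturb_weight_succ {q r₁ r₂ ν α β k : ℕ} (hq₂ : q ≤ r₂)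
    (h : r₁ * ν + 1 ≤ r₁ * α + r₂ * β + q * k) :
    (r₁ * ν + 1) * ν ≤ (r₁ * ν + 1) * α + r₂ * ν * β + r₂ * ν * k := by
  rcases le_or_gt α ν with hαν | hνα
  · obtain ⟨d, rfl⟩ := Nat.exists_eq_add_of_le hαν
    have h1 : r₁ * d + 1 ≤ r₂ * β + q * k := by
      have : r₁ * (α + d) = r₁ * α + r₁ * d := by ring
      omega
    have P1 : (α + d) * (r₁ * d + 1) ≤ (α + d) * (r₂ * β + q * k) := Nat.mul_le_mul_left _ h1
    have P3 : q * ((α + d) * k) ≤ r₂ * ((α + d) * k) := Nat.mul_le_mul_right _ hq₂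
    nlinarith [P1, P3]
  · have h1 : (r₁ * ν + 1) * ν ≤ (r₁ * ν + 1) * α := Nat.mul_le_mul_left _ hνα.le
    omega

/-- **THE PERTURBED TRIPLE**: for `0 < q < r₂ ≤ r₁` and `1 ≤ ν`,
`(g₁^ν) + 𝔪 · F(r₁ν − q) + F(r₁ν + 1) ≤ F_{(g₁,g₂; r₂ν, r₁ν+1, r₂ν)}((r₁ν+1)·ν)` — every element whose `(q;r₁,r₂)`-initial form
lies in `(Y^ν, X)` reaches the admissible triple `(r₂ν; r₁ν+1, r₂ν)` of strictly larger ratio. [OURS · L1 W4.3 · (o70-b)] -/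
theorem span_pow_sup_le_reach_succ (g₁ g₂ : S) {q r₁ r₂ ν : ℕ} (hq : 0 < q) (hq₂ : q < r₂) (hr : r₂ ≤ r₁) (hν : 1 ≤ ν) :
    Ideal.span {g₁ ^ ν} ⊔ maximalIdeal S * flagContactFiltration g₁ g₂ q r₁ r₂ (r₁ * ν - q) ⊔
        flagContactFiltration g₁ g₂ q r₁ r₂ (r₁ * ν + 1) ≤
      flagContactFiltration g₁ g₂ (r₂ * ν) (r₁ * ν + 1) (r₂ * ν) ((r₁ * ν + 1) * ν) := by
  have hQ : 0 < r₂ * ν := Nat.mul_pos (lt_trans hq hq₂) hν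
  refine sup_le (sup_le ?_ ?_) ?_
  · rw [Ideal.span_singleton_le_iff_mem]
    exact pow_left_mem_flagContactFiltration hQ le_rfl
  · exact maximalIdeal_mul_flagContactFiltration_le_of_weights hq hQ fun α β k hk => perturb_weight_mul hq₂ hr hν hk
  · exact flagContactFiltration_le_of_weights hq hQ fun α β k hk => perturb_weight_succ hq₂.le hk

/-! ## §3 LEMMA B — ratio-maximality forbids a solvable first face -/

/-- A shear of the first member along the second keeps the two-flag property. [folklore] -/
theorem IsTwoFlag.add_mul {g₁ g₂ : S} (h : IsTwoFlag g₁ g₂) (s : S) : IsTwoFlag (g₁ + s * g₂) g₂ := by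
  refine ⟨Ideal.add_mem _ h.1 (Ideal.mul_mem_left _ s h.2.1), h.2.1, fun a b hab => ?_⟩
  have hab' : a * g₁ + (a * s + b) * g₂ ∈ maximalIdeal S ^ 2 := by
    have : a * (g₁ + s * g₂) + b * g₂ = a * g₁ + (a * s + b) * g₂ := by ring
    rwa [this] at hab
  obtain ⟨ha, hb⟩ := h.2.2 a (a * s + b) hab'
  refine ⟨ha, ?_⟩
  have : b = (a * s + b) - a * s := by ring
  rw [this]
  exact Ideal.sub_mem _ hb (Ideal.mul_mem_right _ _ ha)

/-- **LEMMA B (unshifted).**  Under the ratio bound `a/b` of the dominance word (`0 < b`) and `r₁ b = a r₂`, for a two-flag `(g₁, g₂)`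
and `q < r₂ ≤ r₁`: `f ∉ (g₁^ν) + 𝔪·F(r₁ν − q) + F(r₁ν + 1)` (`ν = ord f`) — otherwise `(g₁, g₂)` carries `f` to the admissible triple
`(r₂ν; r₁ν+1, r₂ν)` of ratio `> a/b`.  In graded terms: `in(f) ∉ (Y^ν, X)`. [OURS · L1 W4.3 · (o70-b)/(Δ12)] -/
theorem not_mem_span_pow_sup_of_ratio_bound {f : S} {ν : ℕ} (hν : 1 ≤ ν) {a b : ℕ} (hb : 0 < b)
    (hbound : ∀ q' r₁' r₂' : ℕ, AdmissibleTriple q' r₁' r₂' → FlagReaches f ν q' r₁' r₂' → r₁' * b ≤ a * r₂')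
    {g₁ g₂ : S} {q r₁ r₂ : ℕ} (hΦ : IsTwoFlag g₁ g₂) (hadm : AdmissibleTriple q r₁ r₂) (hab : r₁ * b = a * r₂)
    (hq₂ : q < r₂) :
    f ∉ Ideal.span {g₁ ^ ν} ⊔ maximalIdeal S * flagContactFiltration g₁ g₂ q r₁ r₂ (r₁ * ν - q) ⊔
      flagContactFiltration g₁ g₂ q r₁ r₂ (r₁ * ν + 1) := by
  intro hf
  have hreach : FlagReaches f ν (r₂ * ν) (r₁ * ν + 1) (r₂ * ν) :=
    ⟨g₁, g₂, hΦ, span_pow_sup_le_reach_succ g₁ g₂ hadm.1 hq₂ hadm.2.2 hν hf⟩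
  have hadm' : AdmissibleTriple (r₂ * ν) (r₁ * ν + 1) (r₂ * ν) :=
    ⟨Nat.mul_pos (lt_trans hadm.1 hq₂) hν, le_rfl, by nlinarith [hadm.2.2]⟩
  have h := hbound _ _ _ hadm' hreach
  -- `(r₁ν+1) b ≤ a r₂ ν = r₁ b ν`: impossible
  have h2 : a * (r₂ * ν) = r₁ * b * ν := by rw [hab]; ring
  rw [h2] at h
  nlinarith [hb, hν]

/-- **LEMMA B (shifted first member).**  Same, with `r₁ = ρ r₂`: for every `t`, `f ∉ ((g₁ − t g₂^ρ)^ν) + 𝔪·F(r₁ν − q) + F(r₁ν + 1)` —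
the sheared flag `(g₁ − t g₂^ρ, g₂)` has the same filtration at `(q; r₁, r₂)`.  In graded terms: the first face `in(f) mod X ∈ κ[V, Y]`
is not `c·(Y − t̄ V^ρ)^ν` — **exactly ratio-maximal weights are never solvable**. [OURS · L1 W4.3 · (o70-b)/(Δ12)] -/
theorem not_mem_span_shift_pow_sup_of_ratio_bound {f : S} {ν : ℕ} (hν : 1 ≤ ν) {a b : ℕ} (hb : 0 < b)
    (hbound : ∀ q' r₁' r₂' : ℕ, AdmissibleTriple q' r₁' r₂' → FlagReaches f ν q' r₁' r₂' → r₁' * b ≤ a * r₂')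
    {g₁ g₂ : S} {q r₁ r₂ ρ : ℕ} (hΦ : IsTwoFlag g₁ g₂) (hadm : AdmissibleTriple q r₁ r₂) (hab : r₁ * b = a * r₂)
    (hq₂ : q < r₂) (hρ : r₁ = ρ * r₂) (t : S) :
    f ∉ Ideal.span {(g₁ - t * g₂ ^ ρ) ^ ν} ⊔ maximalIdeal S * flagContactFiltration g₁ g₂ q r₁ r₂ (r₁ * ν - q) ⊔
      flagContactFiltration g₁ g₂ q r₁ r₂ (r₁ * ν + 1) := by
  have hq : 0 < q := hadm.1
  have hρ1 : 1 ≤ ρ := by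
    rcases Nat.eq_zero_or_pos ρ with h0 | h0
    · rw [h0, zero_mul] at hρ; exact absurd hadm.2.2 (by omega)
    · exact h0
  -- the sheared flag and the equality of the two filtrations at `(q; r₁, r₂)`
  set g₁' : S := g₁ - t * g₂ ^ ρ with hg₁'
  have hΦ' : IsTwoFlag g₁' g₂ := by
    have : g₁' = g₁ + (-(t * g₂ ^ (ρ - 1))) * g₂ := by
      rw [hg₁', neg_mul, ← sub_eq_add_neg, mul_assoc, ← pow_succ, Nat.sub_add_cancel hρ1]
    rw [this]; exact hΦ.add_mul _
  have hpow : t * g₂ ^ ρ ∈ flagContactFiltration g₁ g₂ q r₁ r₂ r₁ :=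
    Ideal.mul_mem_left _ t (pow_right_mem_flagContactFiltration hq (by rw [hρ, mul_comm]))
  have hpow' : t * g₂ ^ ρ ∈ flagContactFiltration g₁' g₂ q r₁ r₂ r₁ :=
    Ideal.mul_mem_left _ t (pow_right_mem_flagContactFiltration hq (by rw [hρ, mul_comm]))
  have hself := self_mem_flagContactFiltration g₁ g₂ r₁ r₂ hq
  have hself' := self_mem_flagContactFiltration g₁' g₂ r₁ r₂ hq
  have h₁ : g₁' ∈ flagContactFiltration g₁ g₂ q r₁ r₂ r₁ := Ideal.sub_mem _ hself.1 hpow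
  have h₁' : g₁ ∈ flagContactFiltration g₁' g₂ q r₁ r₂ r₁ := by
    have : g₁ = g₁' + t * g₂ ^ ρ := by rw [hg₁']; ring
    rw [this]; exact Ideal.add_mem _ hself'.1 hpow'
  have heq : ∀ n, flagContactFiltration g₁' g₂ q r₁ r₂ n = flagContactFiltration g₁ g₂ q r₁ r₂ n :=
    flagContactFiltration_eq_of_mem_of_mem hq h₁ hself.2 h₁' hself'.2
  have h := not_mem_span_pow_sup_of_ratio_bound hν hb hbound hΦ' hadm hab hq₂
  rwa [heq, heq] at h

end Iota3

end Summit.ResolutionOfSingularities.ResolutionOfSingularities.Cruxes.HypersurfaceCentreConstruction.LocalEngine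

end
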